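import Summits.RiemannHypothesis.RiemannHypothesis.Theorems.TiltedLandingLaw421R3FLinkGainSeam
import Summits.RiemannHypothesis.RiemannHypothesis.Theorems.TiltedLandingLaw421R3TwoPointExact

/-!
# FarTwoPoint (C4 «kernel desk» rh-idea-6 g42, W-09 F-LINK) — (P1)+(P2) of C3's closure map PROVED for SIMPLE lowest states: the GAIN equals (phase kept) / is at most `|δ|` times (norm) the FAR TWO-POINT SUM

r5 = r4 de4158ca879c68be MINUS THE DECLARED TWIN that bounced (p826119 `dedup.landed`, NONLAND #55: `logDeriv_dslope_of_ne'` ≡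
`RhW08.Lens1Coverage.logDeriv_dslope_of_ne`): the formula is now a local `have hlogd` inside ★, not a declaration (importing `…R3Lens1Coverage3`
instead would put `Theses.EarlyAppointments` into this file's cone — (CA855)(3), critic l.9039); ★/★★/★★★ statements and proofs otherwise
byte-identical to r4; 5 theorems.  r4 = r3 split under the 400-line cap: the generic genus-one theorem `twoPoint_exact_dslope` lives in
«TwoPointExact» = LAND #1250 `…Theorems.TiltedLandingLaw421R3TwoPointExact` c41386484ca306c6 (line 2).  r3 = r2 + THE PHASE,
answering C3 g54 LPGAIN (B3) «the phase-free sum prices at .1302·η/s > .118 on the legal R 60 witness — KEEP THE PHASE»: ★ `farList_twoPoint`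
exports the EXACT identity `lineRem z − lineRem z' = Σ'ᵢ (1/(z − aᵢ) − 1/(z' − aᵢ))` next to the norm bound, and ★★★
`lineRem_sub_linePt_eq_farTwoPointSum` states the gain WITH ITS PHASE: `lineRem w − lineRem p₀ = Σ'ᵢ (1/(w − aᵢ) − 1/(p₀ − aᵢ))`, termwise
`= −δ/((w − aᵢ)(p₀ − aᵢ))`.
THE THEOREM (K, standard axioms) ★★ `gain_le_delta_mul_farTwoPointSum`: on a legal frame (`EngineHyps5 2 …`), for a state `v` of level `j` with
`f⁽ʲ⁾ v = 0`, `0 < Im v`, SIMPLE (`f⁽ʲ⁺¹⁾ v ≠ 0`) and `R/2`-isolated (no box / column / lowest-ness binder is used), and a MOVING child `w` of the closed axis disc (`f⁽ʲ⁾ w ≠ 0`, `0 < Im w`,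
`‖w − Re v‖ ≤ Im v`), there is a list `a : ι → ℂ` (weights `m = 1`) of zeros of `f⁽ʲ⁾`, ALL FAR (`R/2 ≤ |Re aᵢ − Re v|`), COMPLETE off `{v, v̄}` and listing each
zero `c ∉ {v, v̄}` exactly `analyticOrderNatAt f⁽ʲ⁾ c` times (exported), with
  `‖lineRem f j v R w − lineRem f j v R p₀‖ ≤ |Re w − Re v| · Σ'ᵢ mᵢ /(‖w − aᵢ‖ · ‖p₀ − aᵢ‖)`,   `p₀ = linePt v w = Re v + i·Im w`,
the series being summable.  This is C3 LOWGAIN §4 (P1) «two-point reduction» and (P2) «the far field's derivative is the far polar sum» in ONE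
statement, in the sharper TWO-POINT form (kernel `1/(‖w−a‖‖p₀−a‖)` instead of `sup_{[p₀,w]} Σ m/|p−a|²`), with NO unproved input and TWO
imports (`…R3FLinkGainSeam` #1241 for `lineRem`/`linePt`; «TwoPointExact» → `…R3GenusOneLogDeriv3` for the genus-one two-point law): the
Hadamard genus-one step is the TREE's `Literature.Analysis.Complex.GenusOneLogDerivC3g41.twoPoint_bound_dslope` (C3 g41, landed
`…R3GenusOneLogDeriv3`, built on `Literature.Analysis.Complex.hadamard_genus_one_zeros`), applied to the cofactor `dslope f⁽ʲ⁾ v` at its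
simple zero `v̄`: the cofactor of the PAIR, `f⁽ʲ⁾/((z−v)(z−v̄))`, has log-derivative `= lineRem f j v R` (`RhW08.FLinkGain.lineRem_eq_farFieldAt_of_simple`)
and its zeros are exactly the zeros of `f⁽ʲ⁾` off `{v, v̄}`, which isolation puts outside the window.
WHAT IT LEAVES for the gain law `RhW08.FLinkGainSeam.RemainderGainBoxSeamSig θ` (simple rows): bound the far two-point sum by `θ·η/(s·|δ|)` —
C3's (P3) cone ratio (C4 128 «ConeRatio» / C3 `conePair_identity`), (P2c)/(P2d) drop budget, and the law-level corner lemma (P5′).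
No declared twins: the dslope log-derivative formula of `…R3Lens1Coverage3` enters only as a LOCAL `have` inside ★ (that module is outside
the allowed import cone); `deriv_dslope_of_ne` / `deriv_dslope_at_zero` (OFF-diagonal dslope derivatives) have no statement twin in Mathlib or
the tree (`exact?` probe; tree-wide `rg 'deriv (dslope'` finds only on-diagonal `deriv (dslope f a) a` sites).  Nothing here bears on the truth of RH; ⟨33346⟩/⟨33347⟩ OPEN.
-/

noncomputable section

namespace RhW08.GainTwoPoint

open Complex Filter Topology Set
open scoped ComplexConjugate
open RhW08.Round1 RhW08.StSwap RhW08.Round2 RhW08.QuadW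
open RhW08.SealSwap (PBot)
open RhW08.SealSwapQ RhW08.RateSplit RhW08.IsolatedTilt RhW08.FarStep RhW08.BurgersRate RhW08.PurseP RhW08.BurgersRateG3
open RhIdea6.G17.W07C7 RhIdea6.G17.W07C7.Rev6 RhIdea6.G18.W07C8.Law421BirthS RhIdea6.G19.W07C11.Seam
open RhIdea6.G20.W07C12.Frac RhIdea6.G20.W07C12.StColP RhW07.C12.FieldSplit RhIdea6.G21.W07C13.TentMax
open RhW07.C14.TwoSided RhW07.C14.Classes RhW07.C14.Lineage RhW07.C14.Booking
open RhW08.FLink RhW08.FLinkGain RhW08.FLinkGainSeam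
open Literature.Analysis.Complex.GenusOneLogDerivC3g41 (norm_dslope_le)
open RhW08.TwoPointExact (twoPoint_exact_dslope)
open Literature.NumberTheory.LFunctions.BurnolVectors (dslope_eq_div differentiable_dslope)
open Summit.RiemannHypothesis.RiemannHypothesis.Theorems.Splittings.JensenWindow (RealEntireLt2)

/-! ## The cofactor calculus (dslope at a zero) -/

/-- (cited, not re-proved: `Literature.NumberTheory.LFunctions.BurnolVectors.dslope_eq_div` — off the centre the dslope at a zero is the quotient
`dslope h w z = h z/(z − w)`; `…BurnolVectors.differentiable_dslope` — the dslope of an entire function is entire.)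
the derivative of the dslope off the centre: `(dslope h w)′(z) = h′(z)/(z − w) − h(z)/(z − w)²`. -/
theorem deriv_dslope_of_ne {h : ℂ → ℂ} (hh : Differentiable ℂ h) {z w : ℂ} (hzw : z ≠ w) (hhw : h w = 0) :
    deriv (dslope h w) z = deriv h z * (z - w)⁻¹ + h z * (-(1 : ℂ) / (z - w) ^ 2) := by
  have hval : ∀ x, x ≠ w → dslope h w x = h x * (x - w)⁻¹ := by
    intro x hx
    rw [dslope_of_ne _ hx, slope_def_field, hhw, sub_zero, div_eq_mul_inv]
  have hev : dslope h w =ᶠ[𝓝 z] fun x => h x * (x - w)⁻¹ := by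
    filter_upwards [isOpen_ne.mem_nhds hzw] with x hx
    exact hval x hx
  have hsub : z - w ≠ 0 := sub_ne_zero.2 hzw
  have hd1 : HasDerivAt h (deriv h z) z := (hh z).hasDerivAt
  have hd2 : HasDerivAt (fun x : ℂ => (x - w)⁻¹) (-(1 : ℂ) / (z - w) ^ 2) z := by
    have := ((hasDerivAt_id z).sub_const w).fun_inv (by simpa using hsub)
    simpa using this
  have hd : HasDerivAt (fun x => h x * (x - w)⁻¹) (deriv h z * (z - w)⁻¹ + h z * (-(1 : ℂ) / (z - w) ^ 2)) z :=
    hd1.mul hd2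
  exact (hd.congr_of_eventuallyEq hev).deriv

/-- at ANOTHER zero `z ≠ w` of `h` the dslope has derivative `h′(z)/(z − w)` — nonzero when `z` is a simple zero. -/
theorem deriv_dslope_at_zero {h : ℂ → ℂ} (hh : Differentiable ℂ h) {z w : ℂ} (hzw : z ≠ w) (hhw : h w = 0) (hhz : h z = 0) :
    deriv (dslope h w) z = deriv h z / (z - w) := by
  rw [deriv_dslope_of_ne hh hzw hhw, hhz, zero_mul, add_zero, div_eq_mul_inv]

/-! ## The pair's cofactor has log-derivative `lineRem` and only far zeros -/

/-- ★ (K) **THE FAR LIST AND ITS TWO-POINT LAW** (simple state; see the module docstring): a complete multiplicity list of the zeros of `f⁽ʲ⁾` off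
`{v, v̄}` — all FAR by isolation — whose two-point sums control the oscillation of `lineRem f j v R` between ANY two non-zeros of `f⁽ʲ⁾` in the open
upper half-plane; the list re-indexes every weighted sum as a sum over `ℂ` against the multiplicity `analyticOrderNatAt f⁽ʲ⁾` (zero weight put at `v, v̄`). -/
theorem farList_twoPoint {η : ℝ} {f : ℂ → ℂ} {x₀ s hmax R Hs : ℝ} {B : ℕ} (hE : EngineHyps5 2 η f x₀ s hmax R Hs B)
    {j : ℕ} {v : ℂ} (hFv : iteratedDeriv j f v = 0) (hv0 : 0 < v.im) (hs : iteratedDeriv (j + 1) f v ≠ 0)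
    (hiso : ∀ z : ℂ, iteratedDeriv j f z = 0 → |z.re - v.re| < R / 2 → z = v ∨ z = conj v) :
    ∃ (ι : Type) (a : ι → ℂ) (m : ι → ℝ), (∀ i, 0 ≤ m i) ∧ (∀ i, m i = 1) ∧
      (∀ i, iteratedDeriv j f (a i) = 0 ∧ R / 2 ≤ |(a i).re - v.re|) ∧
      (∀ z, iteratedDeriv j f z = 0 → z ≠ v → z ≠ conj v → ∃ i, z = a i) ∧
      (∀ c, c ≠ v → c ≠ conj v → {i | a i = c}.ncard = analyticOrderNatAt (iteratedDeriv j f) c) ∧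
      (∀ g : ℂ → ℝ, Summable (fun i ↦ m i * g (a i)) →
        HasSum (fun c : ℂ ↦ (if c = v ∨ c = conj v then (0 : ℝ) else (analyticOrderNatAt (iteratedDeriv j f) c : ℝ)) * g c)
          (∑' i, m i * g (a i))) ∧
      ∀ z z' : ℂ, iteratedDeriv j f z ≠ 0 → 0 < z.im → iteratedDeriv j f z' ≠ 0 → 0 < z'.im →
        (Summable (fun i ↦ m i / (‖z - a i‖ * ‖z' - a i‖)) ∧
          ‖lineRem f j v R z - lineRem f j v R z'‖ ≤ ‖z - z'‖ * ∑' i, m i / (‖z - a i‖ * ‖z' - a i‖)) ∧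
        Summable (fun i ↦ (1 / (z - a i) - 1 / (z' - a i))) ∧
        lineRem f j v R z - lineRem f j v R z' = ∑' i, (1 / (z - a i) - 1 / (z' - a i)) := by
  -- the level `F = f⁽ʲ⁾`: entire, real, of order < 2 (tree), with `F′ = f⁽ʲ⁺¹⁾`
  set F : ℂ → ℂ := iteratedDeriv j f with hFdef
  have hFd : Differentiable ℂ F := differentiable_level hE j
  have hG : RealEntireLt2 F := RhW08.WindowLoss.realEntireLt2_iteratedDeriv (RhW08.Column.realEntireLt2_of_hyps hE) j
  obtain ⟨ρ, C, hρ0, hρ, hgr⟩ := hG.growth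
  have hderivF : deriv F = iteratedDeriv (j + 1) f := by rw [hFdef, ← iteratedDeriv_succ]
  have hvc : v ≠ conj v := ne_conj_of_im_pos hv0
  have hcv : conj v ≠ v := fun h => hvc h.symm
  have hFv' : iteratedDeriv j f v = 0 := hFv
  have hFcv : F (conj v) = 0 := by
    show iteratedDeriv j f (conj v) = 0
    rw [iteratedDeriv_conj hE, hFv', map_zero]
  have hF'cv : deriv F (conj v) ≠ 0 := by
    rw [hderivF, iteratedDeriv_conj hE]
    intro h0
    exact hs (by simpa using congrArg conj h0)
  -- the first cofactor `h₁ = dslope F v`: entire, growth of order < 2, simple zero at `v̄`, non-zero at `v`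
  set h₁ : ℂ → ℂ := dslope F v with hh₁
  have hh₁d : Differentiable ℂ h₁ := differentiable_dslope hFd v
  have hh₁g : ∀ z, ‖h₁ z‖ ≤ (C * Real.exp ((‖v‖ + 1) ^ ρ)) * Real.exp (‖z‖ ^ ρ) := fun z ↦ norm_dslope_le hFd hρ0 hgr hFv z
  have hh₁cv : h₁ (conj v) = 0 := by
    show dslope F v (conj v) = 0
    rw [dslope_eq_div hFv hcv, hFcv, zero_div]
  have hh₁v : h₁ v ≠ 0 := by
    show dslope F v v ≠ 0
    rw [dslope_same, hderivF]
    exact hs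
  have hder : deriv h₁ (conj v) ≠ 0 := by
    show deriv (dslope F v) (conj v) ≠ 0
    rw [deriv_dslope_at_zero hFd hcv hFv hFcv]
    exact div_ne_zero hF'cv (sub_ne_zero.2 hcv)
  -- Hadamard genus one for `h₁` at its simple zero `v̄`: the two-point law, norm and phase, for the pair cofactor `h₂ = dslope h₁ v̄`
  obtain ⟨ι, a, m, hm0, hzero, hm1, hcard, hmult, hlisted, hbound⟩ := twoPoint_exact_dslope hh₁d hh₁g hρ hh₁cv hder
  have hh₂d : Differentiable ℂ (dslope h₁ (conj v)) := differentiable_dslope hh₁d (conj v)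
  have hh₂v : dslope h₁ (conj v) v ≠ 0 := by
    rw [dslope_eq_div hh₁cv hvc]
    exact div_ne_zero hh₁v (sub_ne_zero.2 hvc)
  have hh₂cv : dslope h₁ (conj v) (conj v) ≠ 0 := by
    rw [dslope_same]
    exact hder
  -- the listed zeros are zeros of `F` off `{v, v̄}`, hence FAR by isolation
  have hfar : ∀ i, iteratedDeriv j f (a i) = 0 ∧ R / 2 ≤ |(a i).re - v.re| := by
    intro i
    obtain ⟨hai, haicv⟩ := hzero i
    have haiv : a i ≠ v := by
      intro h
      rw [h] at hai
      exact hh₁v hai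
    have hFai : F (a i) = 0 := by
      have h := hai
      rw [show h₁ (a i) = dslope F v (a i) from rfl, dslope_eq_div hFv haiv] at h
      rcases (div_eq_zero_iff).1 h with h' | h'
      · exact h'
      · exact absurd (sub_eq_zero.1 h') haiv
    refine ⟨hFai, ?_⟩
    by_contra hlt
    rcases hiso (a i) hFai (lt_of_not_ge hlt) with h | h
    · exact haiv h
    · exact haicv h
  -- `F = (z − v)(z − v̄)·h₂` everywhere, so off `{v, v̄}` zeros and orders of `F` and `h₂` agree
  have hfac : ∀ z, F z = (z - v) * ((z - conj v) * dslope h₁ (conj v) z) := by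
    intro z
    have e1 := sub_smul_dslope F v z
    have e2 := sub_smul_dslope h₁ (conj v) z
    rw [hFv, sub_zero, smul_eq_mul] at e1
    rw [hh₁cv, sub_zero, smul_eq_mul] at e2
    rw [← e1, show dslope F v z = h₁ z from rfl, ← e2]
  have hcomplete : ∀ z, iteratedDeriv j f z = 0 → z ≠ v → z ≠ conj v → ∃ i, z = a i := by
    intro z hz hzv hzcv
    have h2 : dslope h₁ (conj v) z = 0 := by
      have := hfac z
      rw [show F z = iteratedDeriv j f z from rfl, hz] at this
      rcases mul_eq_zero.1 this.symm with h | h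
      · exact absurd (sub_eq_zero.1 h) hzv
      · rcases mul_eq_zero.1 h with h' | h'
        · exact absurd (sub_eq_zero.1 h') hzcv
        · exact h'
    obtain ⟨i, hi, -⟩ := hlisted z h2
    exact ⟨i, hi⟩
  have horder : ∀ c, c ≠ v → c ≠ conj v → analyticOrderNatAt (dslope h₁ (conj v)) c = analyticOrderNatAt F c := by
    intro c hcv' hccv
    have hu : AnalyticAt ℂ (fun z : ℂ => (z - v) * (z - conj v)) c := by fun_prop
    have huc : (fun z : ℂ => (z - v) * (z - conj v)) c ≠ 0 := mul_ne_zero (sub_ne_zero.2 hcv') (sub_ne_zero.2 hccv)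
    have hu0 : analyticOrderAt (fun z : ℂ => (z - v) * (z - conj v)) c = 0 := hu.analyticOrderAt_eq_zero.2 huc
    have hh₂a : AnalyticAt ℂ (dslope h₁ (conj v)) c := hh₂d.analyticAt c
    have hfun : (fun z : ℂ => (z - v) * (z - conj v)) * dslope h₁ (conj v) = F := by
      funext z
      rw [Pi.mul_apply, hfac z, mul_assoc]
    have key : analyticOrderAt F c = analyticOrderAt (dslope h₁ (conj v)) c := by
      rw [← hfun, analyticOrderAt_mul hu hh₂a, hu0, zero_add]
    simp only [analyticOrderNatAt, key]
  have hcount : ∀ c, c ≠ v → c ≠ conj v → {i | a i = c}.ncard = analyticOrderNatAt (iteratedDeriv j f) c := by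
    intro c hcv' hccv
    rw [hcard c, horder c hcv' hccv]
  -- re-indexing by multiplicity: the cofactor's order is `0` at `v, v̄` (it does not vanish there) and `F`'s order elsewhere
  have hn0 : ∀ c, dslope h₁ (conj v) c ≠ 0 → (analyticOrderNatAt (dslope h₁ (conj v)) c : ℝ) = 0 := by
    intro c hc
    have h0 : analyticOrderAt (dslope h₁ (conj v)) c = 0 := (hh₂d.analyticAt c).analyticOrderAt_eq_zero.2 hc
    simp [analyticOrderNatAt, h0]
  have hreindex : ∀ g : ℂ → ℝ, Summable (fun i ↦ m i * g (a i)) →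
      HasSum (fun c : ℂ ↦ (if c = v ∨ c = conj v then (0 : ℝ) else (analyticOrderNatAt (iteratedDeriv j f) c : ℝ)) * g c)
        (∑' i, m i * g (a i)) := by
    intro g hg
    have hw : (fun c : ℂ ↦ (if c = v ∨ c = conj v then (0 : ℝ) else (analyticOrderNatAt (iteratedDeriv j f) c : ℝ)) * g c)
        = fun c : ℂ ↦ (analyticOrderNatAt (dslope h₁ (conj v)) c : ℝ) * g c := by
      funext c
      by_cases hc : c = v ∨ c = conj v
      · rw [if_pos hc]
        rcases hc with h | h
        · rw [h, hn0 v hh₂v]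
        · rw [h, hn0 (conj v) hh₂cv]
      · rw [if_neg hc]
        obtain ⟨h1, h2⟩ := not_or.1 hc
        rw [horder c h1 h2]
    rw [hw]
    exact hmult g hg
  -- generic: for `z ∉ {v, v̄}` with `F z ≠ 0` (any `z` with `0 < Im z`, `F z ≠ 0`), `h₂ z ≠ 0` and `h₂′/h₂ (z) = lineRem f j v R z`
  have hcof : ∀ z : ℂ, iteratedDeriv j f z ≠ 0 → 0 < z.im →
      dslope h₁ (conj v) z ≠ 0 ∧ deriv (dslope h₁ (conj v)) z / dslope h₁ (conj v) z = lineRem f j v R z := by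
    intro z hz hzim
    have hzv : z ≠ v := by
      intro h; rw [h] at hz; exact hz hFv
    have hzcv : z ≠ conj v := by
      intro h
      have := congrArg Complex.im h
      rw [Complex.conj_im] at this
      linarith
    have hh₁z : h₁ z ≠ 0 := by
      show dslope F v z ≠ 0
      rw [dslope_eq_div hFv hzv]
      exact div_ne_zero hz (sub_ne_zero.2 hzv)
    refine ⟨?_, ?_⟩
    · rw [dslope_eq_div hh₁cv hzcv]
      exact div_ne_zero hh₁z (sub_ne_zero.2 hzcv)
    · -- log-derivative of a dslope off the centre (= the tree's `RhW08.Lens1Coverage.logDeriv_dslope_of_ne` of `…R3Lens1Coverage3`, whose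
      -- import lies outside this file's allowed cone, (CA855)(3)); re-derived as a LOCAL fact, not a declaration (NONLAND #55 lesson)
      have hlogd : ∀ {h : ℂ → ℂ}, Differentiable ℂ h → ∀ {z w : ℂ}, z ≠ w → h w = 0 → h z ≠ 0 →
          deriv (dslope h w) z / dslope h w z = deriv h z / h z - 1 / (z - w) := by
        intro h hh z w hzw hhw hhz
        have hsub : z - w ≠ 0 := sub_ne_zero.2 hzw
        rw [deriv_dslope_of_ne hh hzw hhw, dslope_eq_div hhw hzw]
        field_simp
        ring
      rw [hlogd hh₁d hzcv hh₁cv hh₁z,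
        show deriv h₁ z / h₁ z = deriv (dslope F v) z / dslope F v z from rfl,
        hlogd hFd hzv hFv hz, hderivF,
        lineRem_eq_farFieldAt_of_simple hE hFv hs hv0 hiso z, farFieldAt, levelField]
  refine ⟨ι, a, m, hm0, hm1, hfar, hcomplete, hcount, hreindex, ?_⟩
  intro z z' hz hzim hz' hz'im
  obtain ⟨h₂z, hzlog⟩ := hcof z hz hzim
  obtain ⟨h₂z', hz'log⟩ := hcof z' hz' hz'im
  obtain ⟨⟨hsum, hle⟩, hsumc, hid⟩ := hbound z z' h₂z h₂z'
  rw [← hzlog, ← hz'log]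
  exact ⟨⟨hsum, hle⟩, hsumc, hid⟩

/-- ★★ (K) **(P1)+(P2): THE GAIN IS AT MOST `|δ|` TIMES THE FAR TWO-POINT SUM** — `farList_twoPoint` between the moving child `w` of the closed
axis disc and its foot `p₀ = linePt v w` on the axis `Re z = Re v` (`‖w − p₀‖ = |Re w − Re v|`). -/
theorem gain_le_delta_mul_farTwoPointSum {η : ℝ} {f : ℂ → ℂ} {x₀ s hmax R Hs : ℝ} {B : ℕ} (hE : EngineHyps5 2 η f x₀ s hmax R Hs B)
    {j : ℕ} {v w : ℂ} (hFv : iteratedDeriv j f v = 0) (hv0 : 0 < v.im) (hs : iteratedDeriv (j + 1) f v ≠ 0)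
    (hiso : ∀ z : ℂ, iteratedDeriv j f z = 0 → |z.re - v.re| < R / 2 → z = v ∨ z = conj v)
    (hw : iteratedDeriv j f w ≠ 0) (hwim : 0 < w.im) (hd : ‖w - (v.re : ℂ)‖ ≤ |v.im|) :
    ∃ (ι : Type) (a : ι → ℂ) (m : ι → ℝ), (∀ i, 0 ≤ m i) ∧ (∀ i, m i = 1) ∧
      (∀ i, iteratedDeriv j f (a i) = 0 ∧ R / 2 ≤ |(a i).re - v.re|) ∧
      (∀ z, iteratedDeriv j f z = 0 → z ≠ v → z ≠ conj v → ∃ i, z = a i) ∧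
      (∀ c, c ≠ v → c ≠ conj v → {i | a i = c}.ncard = analyticOrderNatAt (iteratedDeriv j f) c) ∧
      Summable (fun i ↦ m i / (‖w - a i‖ * ‖linePt v w - a i‖)) ∧
      ‖lineRem f j v R w - lineRem f j v R (linePt v w)‖
        ≤ |w.re - v.re| * ∑' i, m i / (‖w - a i‖ * ‖linePt v w - a i‖) := by
  have hR : 0 < R := RhW08.ClusterQ.R_pos_of_engine hE
  obtain ⟨ι, a, m, hm0, hm1, hfar, hcomplete, hcount, -, htwo⟩ := farList_twoPoint hE hFv hv0 hs hiso
  have hp0 : iteratedDeriv j f (linePt v w) ≠ 0 := iteratedDeriv_linePt_ne_zero hiso hv0 hwim hd hw hR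
  obtain ⟨⟨hsum, hle⟩, -, -⟩ := htwo w (linePt v w) hw hwim hp0 (by rw [linePt_im]; exact hwim)
  -- the segment's length `‖w − p₀‖ = |δ|` (127 «SegmentMVT»'s `norm_sub_linePt`, inlined here to keep the two images independent)
  have hlen : ‖w - linePt v w‖ = |w.re - v.re| := by
    have h : w - linePt v w = ((w.re - v.re : ℝ) : ℂ) := Complex.ext (by simp [linePt]) (by simp [linePt])
    rw [h, Complex.norm_real, Real.norm_eq_abs]
  refine ⟨ι, a, m, hm0, hm1, hfar, hcomplete, hcount, hsum, ?_⟩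
  rw [← hlen]
  exact hle


/-- ★★★ (K) **THE GAIN WITH ITS PHASE** (C3 g54 LPGAIN (B3): «keep the phase»): between the moving child `w` and its foot `p₀ = linePt v w` the
far remainder changes by the EXACT far two-point sum, `lineRem w − lineRem p₀ = Σ'ᵢ (1/(w − aᵢ) − 1/(p₀ − aᵢ))` (`= −δ·Σ'ᵢ 1/((w − aᵢ)(p₀ − aᵢ))`
termwise, `δ = Re w − Re v`), over a complete multiplicity list of FAR zeros of `f⁽ʲ⁾` off `{v, v̄}` — so the projected gain
`Re(conj Ĝ · (G w − G p₀))` is available term by term, not only its norm. -/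
theorem lineRem_sub_linePt_eq_farTwoPointSum {η : ℝ} {f : ℂ → ℂ} {x₀ s hmax R Hs : ℝ} {B : ℕ} (hE : EngineHyps5 2 η f x₀ s hmax R Hs B)
    {j : ℕ} {v w : ℂ} (hFv : iteratedDeriv j f v = 0) (hv0 : 0 < v.im) (hs : iteratedDeriv (j + 1) f v ≠ 0)
    (hiso : ∀ z : ℂ, iteratedDeriv j f z = 0 → |z.re - v.re| < R / 2 → z = v ∨ z = conj v)
    (hw : iteratedDeriv j f w ≠ 0) (hwim : 0 < w.im) (hd : ‖w - (v.re : ℂ)‖ ≤ |v.im|) :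
    ∃ (ι : Type) (a : ι → ℂ), (∀ i, iteratedDeriv j f (a i) = 0 ∧ R / 2 ≤ |(a i).re - v.re|) ∧
      (∀ z, iteratedDeriv j f z = 0 → z ≠ v → z ≠ conj v → ∃ i, z = a i) ∧
      (∀ c, c ≠ v → c ≠ conj v → {i | a i = c}.ncard = analyticOrderNatAt (iteratedDeriv j f) c) ∧
      (∀ i, 1 / (w - a i) - 1 / (linePt v w - a i) = -(((w.re - v.re : ℝ) : ℂ) / ((w - a i) * (linePt v w - a i)))) ∧
      Summable (fun i ↦ (1 / (w - a i) - 1 / (linePt v w - a i))) ∧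
      lineRem f j v R w - lineRem f j v R (linePt v w) = ∑' i, (1 / (w - a i) - 1 / (linePt v w - a i)) := by
  have hR : 0 < R := RhW08.ClusterQ.R_pos_of_engine hE
  obtain ⟨ι, a, m, -, -, hfar, hcomplete, hcount, -, htwo⟩ := farList_twoPoint hE hFv hv0 hs hiso
  have hp0 : iteratedDeriv j f (linePt v w) ≠ 0 := iteratedDeriv_linePt_ne_zero hiso hv0 hwim hd hw hR
  obtain ⟨-, hsumc, hid⟩ := htwo w (linePt v w) hw hwim hp0 (by rw [linePt_im]; exact hwim)
  refine ⟨ι, a, hfar, hcomplete, hcount, fun i ↦ ?_, hsumc, hid⟩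
  -- termwise: `1/(w − a) − 1/(p₀ − a) = −(w − p₀)/((w − a)(p₀ − a))`, `w − p₀ = δ` real
  have hwa : w - a i ≠ 0 := by
    intro h
    exact hw (by rw [sub_eq_zero.1 h]; exact (hfar i).1)
  have hpa : linePt v w - a i ≠ 0 := by
    intro h
    exact hp0 (by rw [sub_eq_zero.1 h]; exact (hfar i).1)
  have hδ : w - linePt v w = ((w.re - v.re : ℝ) : ℂ) := Complex.ext (by simp [linePt]) (by simp [linePt])
  rw [div_sub_div _ _ hwa hpa, ← neg_div, ← hδ]
  congr 1
  ring

end RhW08.GainTwoPoint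

end
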